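import Summits.BirchSwinnertonDyer.Rank1Residual.X11a.PartnerOrdinary
import HarnessLib

/-!
# Class X11a, route (3d): at a NON-SPLIT pair the good congruent partner has `a_p ≡ -1 (mod p)`
# (cell `b2b-bsdres`, unit `b2b-bsdres-x11a`, gen 25)

HONEST FRAMING (run/shared/lean/b2b/bsd-rank1-residual/, verbatim in every file): the goal of the
cell is to DELETE the COMBINATION-SHAPED residual classes of the Birch–Swinnerton-Dyer formula for
ALL analytic-rank `≤ 1` elliptic curves over `ℚ` — "full BSD formula for every rank `≤ 1` curve in
class `C`" assembled STRICTLY from published theorems — so that the rank-`≤ 1` remainder becomes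
exactly the CONSTRUCTION-SHAPED classes, which are TYPED (missing-input `Prop`s), NOT attempted.
This is not "finishing BSD". Research route; NO CLAIM BEYOND STATED CLASSES. Theorems only; no
definition, no new named fact; nothing booked; no label change.

WHAT. For `E` multiplicative at the odd prime `p`, `A` good at `p`, `e : A[p] ≃ E[p]` `Γ_ℚ`-equivariant,
gen 24 proved SPLIT ⇒ `p ∣ a_p(A) - 1`, NON-SPLIT ⇒ `p ∤ a_p(A) - 1` (`X11a/PartnerSplitType.lean`);
gen 25 removed the ordinarity hypothesis (`X11a/PartnerOrdinary.lean`). THIS FILE proves the sharp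
non-split statement **`p ∣ a_p(A) + 1`** (`dvd_frobeniusTrace_add_one_of_equiv_of_not_split`):
`a_p(A) ≡ a_p(E) (mod p)` on every congruent pair — the census observation (g24/g25: 38/38 non-split,
19/19 split certified rows) as a kernel theorem. §1 a GLOBAL arithmetic Frobenius `σ` at a prime
`𝔓 ∣ p` of `\bar ℤ` flips `√(-c₄c₆)` (Euler's criterion `int_dvd_pow_div_two_add_one_of_not_split`
read through `σ z ≡ z^p (mod 𝔓)`); §2–§3 the Tate line `X₀ ≤ E[p]` (granted the twisted Tate
uniformisation A41): `D_𝔓` acts on `E[p]/X₀` by the sign `g ↦ g(√γ)/√γ`, `γ = -c₄/c₆`, and `I_𝔓`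
trivially — at the embedding's prime by `X2.GreenbergVatsalTateDatumSign.smul_sub_sign_smul_mem`,
at every `𝔓 ∣ p` by conjugation; §4 along `e` the kernel of reduction `X_A ≤ A[p]` (order `p`, moved
by `I_𝔓`, `σ ≡ a_p(A)` on `A[p]/X_A`: x1a's `AnomalousDictionaryProofs`) maps onto `X₀` (else `I_𝔓`,
trivial on `E[p]/X₀`, would fix `X_A`), so `(a_p(A) + 1) E[p] ⊆ X₀` and `p ∣ a_p(A) + 1`. Granted: A41
only; everything else is a tree theorem. Nothing booked; the class label is unchanged.

References: [Serre1972] §1.11 (1), Prop. 11–12, §1.12; [GreenbergVatsal2000] §2 pp. 14–15;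
[SilvermanATAEC1994] V.5.2 (c), 5.3, 5.4, Ex. 5.11; HOME/b2b-bsdres-x11a/REPORT-g25.md.
-/

noncomputable section

open scoped Classical NumberField Pointwise

open NumberField IsDedekindDomain Field WeierstrassCurve
  Literature.NumberTheory.EllipticCurves Literature.NumberTheory.GaloisRepresentations
  Literature.NumberTheory.EllipticCurves.GreenbergSelmer
  Literature.NumberTheory.EllipticCurves.Rank1Residual
  Rat.HeightOneSpectrum
  Summit.BirchSwinnertonDyer.Rank1Residual.X2.GreenbergVatsalTateDatum
  Summit.BirchSwinnertonDyer.Rank1Residual.X2.GreenbergVatsalTateDatumSign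
  Summit.BirchSwinnertonDyer.Rank1Residual.X2.GreenbergVatsalTateDatumCofree
  Summit.BirchSwinnertonDyer.Rank1Residual.X2.GreenbergVatsalTateFrobeniusSign

set_option autoImplicit false

namespace Summit.BirchSwinnertonDyer.Rank1Residual.X11a.PartnerNonsplitSign

variable {W A : WeierstrassCurve ℚ} [W.IsElliptic] [W.IsGloballyMinimal] [A.IsElliptic]
  [A.IsGloballyMinimal] {p : ℕ} [hp : Fact p.Prime]

/-! ## §1. A global arithmetic Frobenius above `p` flips a square root of a non-residue -/

omit [W.IsElliptic] [W.IsGloballyMinimal] [A.IsElliptic] [A.IsGloballyMinimal] in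
/-- **Euler's criterion, Galois form.** Let `𝔓` be the prime of `\bar ℤ` cut out by the place
`placeOver p` (`p` odd), `σ ∈ Γ_ℚ` an arithmetic Frobenius at `𝔓`, `G ∈ ℤ` with `p ∤ G` and
`p ∣ G^{(p-1)/2} + 1` (a non-residue), and `t ∈ ℚ̄` with `t² = G`. Then `σ t = -t`:
`σ t ≡ t^p = t · G^{(p-1)/2} ≡ -t (mod 𝔪_𝔓)`, `σ t = ± t`, and `σ t = t` would give `2t ∈ 𝔪_𝔓`,
absurd since `2t` is a `𝔓`-unit. [cite: Serre1972, §1.11 (1)] -/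
theorem frob_smul_eq_neg_of_sq_eq_intCast (hp2 : p ≠ 2) {𝔓 : Ideal (absIntegers (𝓞 ℚ) ℚ)}
    (hmem : ∀ x : absIntegers (𝓞 ℚ) ℚ, x ∈ 𝔓 ↔ (x : AlgebraicClosure ℚ) ∈ (placeOver p).nonunits)
    {v : HeightOneSpectrum (𝓞 ℚ)} (hv : (primesEquiv v : ℕ) = p) (h𝔓 : 𝔓 ∈ v.primesAbove)
    {σ : absoluteGaloisGroup ℚ} (hσ : IsArithFrobAt (𝓞 ℚ) σ 𝔓)
    {G : ℤ} (hG : ¬ (p : ℤ) ∣ G) (hEuler : (p : ℤ) ∣ G ^ (p / 2) + 1)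
    {t : AlgebraicClosure ℚ} (ht : t ^ 2 = (G : AlgebraicClosure ℚ)) : σ • t = -t := by
  have hpp := hp.out
  set w := (placeOver p).valuation with hw
  have hwt : w t = 1 := by -- `t` is a `𝔓`-unit
    have h2 : w t ^ 2 = 1 := by rw [← map_pow, ht, valuation_placeOver_intCast_eq_one p hG]
    exact (pow_eq_one_iff.mp h2).resolve_right two_ne_zero
  have htmem : t ∈ placeOver p := ((placeOver p).valuation_le_one_iff _).mp hwt.le
  have h1 : w (σ • t - t ^ p) < 1 := -- `σ t - t^p ∈ 𝔪`
    valuation_smul_sub_pow_lt_one_of_isArithFrobAt hmem hv h𝔓 hσ htmem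
  obtain ⟨k, hk⟩ := hEuler -- `t^p = -t + p k t`
  have hodd : p = 2 * (p / 2) + 1 := by have := Nat.odd_iff.mp (hpp.odd_of_ne_two hp2); omega
  have htp : t ^ p = -t + (p : AlgebraicClosure ℚ) * k * t := by
    have hGpow : ((G : AlgebraicClosure ℚ)) ^ (p / 2) = (p : AlgebraicClosure ℚ) * k - 1 := by
      have := congrArg (fun z : ℤ ↦ (z : AlgebraicClosure ℚ)) hk
      push_cast at this; linear_combination this
    conv_lhs => rw [hodd, pow_succ, pow_mul, ht, hGpow]
    ring
  have h2 : w (σ • t + t) < 1 := by -- hence `σ t + t ∈ 𝔪`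
    have hsplit : σ • t + t = (σ • t - t ^ p) + (p : AlgebraicClosure ℚ) * k * t := by rw [htp]; ring
    rw [hsplit]
    refine Valuation.map_add_lt _ h1 ?_
    rw [map_mul, map_mul, hwt, mul_one]
    have hwk : w (k : AlgebraicClosure ℚ) ≤ 1 :=
      ((placeOver p).valuation_le_one_iff _).mpr (intCast_mem _ k)
    exact mul_lt_one_of_nonneg_of_lt_one_left zero_le (valuation_placeOver_natCast_lt_one p) hwk
  have hsq : (σ • t) ^ 2 = t ^ 2 := by -- `σ t = ± t`
    rw [← smul_pow', ht, absoluteGaloisGroup.smul_def, map_intCast]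
  rcases sq_eq_sq_iff_eq_or_eq_neg.mp hsq with hfix | hneg
  · -- `σ t = t`: `2t ∈ 𝔪`, but `w (2t) = 1`
    exfalso
    rw [hfix, ← two_mul] at h2
    have h2ndvd : ¬ (p : ℤ) ∣ 2 := fun h ↦ by
      have : (p : ℤ) ≤ 2 := Int.le_of_dvd two_pos h; have : 2 ≤ p := hpp.two_le; omega
    have hw2 : w (2 : AlgebraicClosure ℚ) = 1 := by
      have := valuation_placeOver_intCast_eq_one p h2ndvd; rwa [Int.cast_ofNat] at this
    rw [map_mul, hw2, hwt, mul_one] at h2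
    exact lt_irrefl _ h2
  · exact hneg

/-! ## §2. The Tate line: `D` acts on `E[p]/X₀` through the sign on `√γ`, `I` trivially -/

omit [A.IsElliptic] [A.IsGloballyMinimal] in
/-- **The Tate line at the embedding's prime `𝔓₀`** (granted A41, the twisted Tate uniformisation):
for `E = W/ℚ` multiplicative at the odd prime `p`, `v ∋ p`, and `t₀ ∈ ℚ̄` with `t₀² = γ = -c₄/c₆`,
there is `X₀ ≤ E[p]` of order `p`, stable under `D_v = D_{𝔓₀}`, such that every `g ∈ D_v` acts on
`E[p]/X₀` by the sign `g t₀ / t₀ ∈ {±1}` and the inertia group `I_v` acts trivially on `E[p]/X₀`.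
(`X₀ = C ∩ E[p]` for the Tate datum `C = ι⁻¹Φ(μ)`; `smul_sub_sign_smul_mem` read through the chosen
embedding `ℚ̄ → ℚ̄_v`, under which the local root `t` is `± t₀`.)
[cite: GreenbergVatsal2000, §2 pp. 14–15] [cite: SilvermanATAEC1994, Ch. V Lemma 5.2 (c), Thm. 5.3, Cor. 5.4] -/
theorem exists_tateLine_sign_decomp (hT : Silverman1994_thmV53_corV54_tateUniformisation.{0})
    (hp2 : p ≠ 2) (hmult : W.HasMultiplicativeReductionAtPrime p)
    {v : HeightOneSpectrum (𝓞 ℚ)} (hv : (primesEquiv v : ℕ) = p)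
    {t₀ : AlgebraicClosure ℚ} (ht₀ : t₀ ^ 2 = algebraMap ℚ (AlgebraicClosure ℚ) (-(W.c₄ / W.c₆))) :
    ∃ X₀ : AddSubgroup (geomTorsion W (p : ℤ)), Nat.card X₀ = p ∧
      (∀ g ∈ decomp (K := ℚ) v, ∀ P ∈ X₀, g • P ∈ X₀) ∧
      (∀ g ∈ decomp (K := ℚ) v, ∀ P : geomTorsion W (p : ℤ),
        g • P - (if g • t₀ = t₀ then (1 : ℤ) else -1) • P ∈ X₀) ∧
      (∀ τ ∈ inertia (K := ℚ) v, ∀ P : geomTorsion W (p : ℤ), τ • P - P ∈ X₀) := by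
  have hpv : ((p : ℕ) : 𝓞 ℚ) ∈ v.asIdeal := natCast_mem_asIdeal_of_primesEquiv_eq hv
  obtain ⟨q, t, Ψ, hq0, hq1, -, ht2, hsurj, hker, hΨσ, -⟩ :=
    hT W v (X2.GreenbergVatsalStrictSelmerMultiplicative.hasMultiplicativeReductionAt_of_mem W p
      hmult hpv)
  have hker' : ∀ u : (AlgebraicClosure (v.adicCompletion ℚ))ˣ, Ψ (Additive.ofMul u) = 0 →
      ∃ a : ℤ, (u : AlgebraicClosure (v.adicCompletion ℚ)) =
        algebraMap (v.adicCompletion ℚ) (AlgebraicClosure (v.adicCompletion ℚ)) q ^ a :=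
    fun u h ↦ (hker u).1 h
  set N := tateDatum W p Ψ (sign_disj W Ψ t hΨσ) with hN
  set X := N.plus.comap (AddSubgroup.inclusion (geomTorsion_le_geomPrimaryTorsion W p)) with hXdef
  have hXcard : Nat.card X = p := by
    rw [hXdef, X2.TateLineDecomposition.natCard_comap_eq W p N, hN]
    exact natCard_tateDatum_plus_inf_torsionBy W p Ψ _ hq0 hq1 hker'
  -- the local root `t` is `± ι t₀` for the chosen embedding `ι : ℚ̄ → ℚ̄_v`
  set ι := absClosureEmbedding ℚ (v.adicCompletion ℚ) with hι
  have hιinj : Function.Injective ι := ι.toRingHom.injective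
  have hιt₀ : (ι t₀) ^ 2 = t ^ 2 := by
    have hγ₁ : ι (algebraMap ℚ (AlgebraicClosure ℚ) (-(W.c₄ / W.c₆))) =
        ((-(W.c₄ / W.c₆) : ℚ) : AlgebraicClosure (v.adicCompletion ℚ)) := by
      rw [eq_ratCast (algebraMap ℚ (AlgebraicClosure ℚ)), map_ratCast]
    have hγ₂ : algebraMap (v.adicCompletion ℚ) (AlgebraicClosure (v.adicCompletion ℚ))
        (algebraMap ℚ (v.adicCompletion ℚ) (-(W.c₄ / W.c₆))) =
        ((-(W.c₄ / W.c₆) : ℚ) : AlgebraicClosure (v.adicCompletion ℚ)) := by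
      rw [← RingHom.comp_apply, eq_ratCast]
    rw [← map_pow, ht₀, ht2, hγ₁, hγ₂]
  have hsign : ∀ σ : absoluteGaloisGroup (v.adicCompletion ℚ),
      (Field.absoluteGaloisGroup.toAlgEquiv (v.adicCompletion ℚ) σ t = t) ↔
        (absGaloisRestrict ℚ (v.adicCompletion ℚ) σ • t₀ = t₀) := by
    intro σ
    have hemb : σ • ι t₀ = ι (absGaloisRestrict ℚ (v.adicCompletion ℚ) σ • t₀) :=
      (absGaloisRestrict_apply_smul ℚ (v.adicCompletion ℚ) σ t₀).symm
    rw [← absoluteGaloisGroup.smul_def]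
    rcases sq_eq_sq_iff_eq_or_eq_neg.mp hιt₀ with h | h
    · rw [← h, hemb]
      exact ⟨fun h1 ↦ hιinj h1, fun h1 ↦ by rw [h1]⟩
    · have ht' : t = -ι t₀ := by rw [h, neg_neg]
      rw [ht', smul_neg, neg_inj, hemb]
      exact ⟨fun h1 ↦ hιinj h1, fun h1 ↦ by rw [h1]⟩
  refine ⟨X, hXcard,
    fun g hg P hP ↦ X2.TateLineDecomposition.smul_mem_comap_of_mem_decomp W p N hg hP, ?_, ?_⟩
  · -- the sign clause
    intro g hg P
    obtain ⟨σ, rfl⟩ := hg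
    change absGaloisRestrict ℚ (v.adicCompletion ℚ) σ • P -
        (if absGaloisRestrict ℚ (v.adicCompletion ℚ) σ • t₀ = t₀ then (1 : ℤ) else -1) • P ∈ X
    have key : ∀ m : W.geomPrimaryTorsion p, absGaloisRestrict ℚ (v.adicCompletion ℚ) σ • m -
        (if absGaloisRestrict ℚ (v.adicCompletion ℚ) σ • t₀ = t₀ then (1 : ℤ) else -1) • m ∈
          N.plus := by
      intro m
      have h := smul_sub_sign_smul_mem W p Ψ t hΨσ hsurj hker' σ m
      by_cases hfix : absGaloisRestrict ℚ (v.adicCompletion ℚ) σ • t₀ = t₀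
      · rw [if_pos ((hsign σ).mpr hfix)] at h
        rwa [if_pos hfix]
      · rw [if_neg (fun h' ↦ hfix ((hsign σ).mp h'))] at h
        rwa [if_neg hfix]
    exact X2.TateLineDecomposition.smul_sub_zsmul_mem_comap W p N key P
  · -- the inertia clause
    intro τ hτ P
    obtain ⟨σ, hσ, rfl⟩ := Subgroup.mem_map.mp hτ
    change absGaloisRestrict ℚ (v.adicCompletion ℚ) σ • P - P ∈ X
    have hfixt : Field.absoluteGaloisGroup.toAlgEquiv (v.adicCompletion ℚ) σ t = t :=
      X2.GreenbergVatsalTateDatumRat.inertia_fix_sqrt_gamma W hp2 hmult hpv t ht2 σ hσ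
    have key : ∀ m : W.geomPrimaryTorsion p,
        absGaloisRestrict ℚ (v.adicCompletion ℚ) σ • m - (1 : ℤ) • m ∈ N.plus := by
      intro m
      have h := smul_sub_sign_smul_mem W p Ψ t hΨσ hsurj hker' σ m
      rwa [if_pos hfixt] at h
    have h1 := X2.TateLineDecomposition.smul_sub_zsmul_mem_comap W p N key P
    rwa [one_zsmul] at h1

/-! ## §3. The same at every prime `𝔓 ∣ p` of `\bar ℤ` -/

omit [W.IsElliptic] [W.IsGloballyMinimal] [A.IsElliptic] [A.IsGloballyMinimal] hp in
/-- A Galois automorphism maps a square root of a rational number to `±` itself. [folklore] -/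
theorem smul_eq_self_or_eq_neg_of_sq_eq_algebraMap (g : absoluteGaloisGroup ℚ) {t₀ : AlgebraicClosure ℚ}
    {c : ℚ} (ht₀ : t₀ ^ 2 = algebraMap ℚ (AlgebraicClosure ℚ) c) : g • t₀ = t₀ ∨ g • t₀ = -t₀ := by
  apply sq_eq_sq_iff_eq_or_eq_neg.mp
  rw [← smul_pow', ht₀, absoluteGaloisGroup.smul_def, eq_ratCast, map_ratCast]

omit [W.IsElliptic] [W.IsGloballyMinimal] [A.IsElliptic] [A.IsGloballyMinimal] hp in
/-- The sign `h ↦ [h t₀ = t₀]` is invariant under conjugation: `(g⁻¹ h g) t₀ = t₀ ↔ h t₀ = t₀`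
(`g t₀ = ± t₀`). [folklore] -/
theorem conj_smul_eq_iff (g h : absoluteGaloisGroup ℚ) {t₀ : AlgebraicClosure ℚ} {c : ℚ}
    (ht₀ : t₀ ^ 2 = algebraMap ℚ (AlgebraicClosure ℚ) c) :
    (g⁻¹ * h * g) • t₀ = t₀ ↔ h • t₀ = t₀ := by
  rw [mul_smul, mul_smul, inv_smul_eq_iff]
  rcases smul_eq_self_or_eq_neg_of_sq_eq_algebraMap g ht₀ with hg | hg
  · rw [hg]
  · rw [hg, smul_neg, neg_inj]

set_option synthInstance.maxHeartbeats 100000 in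
omit [A.IsElliptic] [A.IsGloballyMinimal] in
/-- **The Tate line at ANY prime `𝔓 ∣ p` of `\bar ℤ`** (granted A41): `X₀ ≤ E[p]` of order `p`,
`D_𝔓`-stable, with `D_𝔓` acting on `E[p]/X₀` by the sign `g ↦ g t₀/t₀` and `I_𝔓` trivially —
§2 moved along `g • 𝔓₀ = 𝔓` (`X₀ ↦ g • X₀`; the sign is conjugation invariant, `conj_smul_eq_iff`).
[cite: GreenbergVatsal2000, §2 pp. 14–15] [cite: NeukirchANT1999, Ch. I §9 Prop. (9.4)]
[cite: SilvermanATAEC1994, Ch. V Lemma 5.2 (c), Thm. 5.3, Cor. 5.4] -/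
theorem exists_tateLine_sign_of_mem_primesAbove
    (hT : Silverman1994_thmV53_corV54_tateUniformisation.{0})
    (hp2 : p ≠ 2) (hmult : W.HasMultiplicativeReductionAtPrime p)
    {v : HeightOneSpectrum (𝓞 ℚ)} (hv : (primesEquiv v : ℕ) = p)
    {𝔓 : Ideal (absIntegers (𝓞 ℚ) ℚ)} (h𝔓 : 𝔓 ∈ v.primesAbove)
    {t₀ : AlgebraicClosure ℚ} (ht₀ : t₀ ^ 2 = algebraMap ℚ (AlgebraicClosure ℚ) (-(W.c₄ / W.c₆))) :
    ∃ X₀ : AddSubgroup (geomTorsion W (p : ℤ)), Nat.card X₀ = p ∧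
      (∀ g ∈ 𝔓.decompositionSubgroup (absoluteGaloisGroup ℚ), ∀ P ∈ X₀, g • P ∈ X₀) ∧
      (∀ g ∈ 𝔓.decompositionSubgroup (absoluteGaloisGroup ℚ), ∀ P : geomTorsion W (p : ℤ),
        g • P - (if g • t₀ = t₀ then (1 : ℤ) else -1) • P ∈ X₀) ∧
      (∀ τ ∈ 𝔓.inertia (absoluteGaloisGroup ℚ), ∀ P : geomTorsion W (p : ℤ), τ • P - P ∈ X₀) := by
  have h𝔓₀ := adicCompletionPrime_mem_primesAbove ℚ v
  obtain ⟨g, hg⟩ :=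
    HeightOneSpectrum.exists_smul_eq_of_mem_primesAbove_holds (K := ℚ) (v := v) h𝔓₀ h𝔓
  have hg' : g⁻¹ • 𝔓 = adicCompletionPrime ℚ v := by rw [← hg, inv_smul_smul]
  obtain ⟨X₀, hcard, hst, hsg, hin⟩ := exists_tateLine_sign_decomp hT hp2 hmult hv ht₀
  set X₁ := X₀.map (DistribSMul.toAddMonoidHom (geomTorsion W (p : ℤ)) g) with hX₁
  have hmem₁ : ∀ Q : geomTorsion W (p : ℤ), Q ∈ X₁ ↔ g⁻¹ • Q ∈ X₀ := fun Q ↦ by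
    rw [hX₁, PartnerSplitType.mem_map_smul_iff]
  -- conjugation into `D_{𝔓₀} = decomp v` and `I_{𝔓₀} = inertia v`
  have hconjD : ∀ h ∈ 𝔓.decompositionSubgroup (absoluteGaloisGroup ℚ),
      g⁻¹ * h * g ∈ decomp (K := ℚ) v := fun h hh ↦ by
    have h1 := conj_mem_decompositionSubgroup_of_smul_eq hg' hh
    rw [inv_inv] at h1
    exact (X2.CongruentPartnerAnomalous.mem_decompositionSubgroup_adicCompletionPrime_iff v _).mp h1
  have hconjI : ∀ τ ∈ 𝔓.inertia (absoluteGaloisGroup ℚ), g⁻¹ * τ * g ∈ inertia (K := ℚ) v := by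
    intro τ hτ
    rw [← hg] at hτ
    have h1 := DegreeOnePrimes.conj_mem_inertia_of_mem_inertia_smul hτ
    rw [inertia_adicCompletionPrime_eq_map_absInertia] at h1
    exact h1
  refine ⟨X₁, ?_, ?_, ?_, ?_⟩
  · rw [hX₁, PartnerSplitType.card_map_smul]; exact hcard
  · intro h hh P hP
    rw [hmem₁] at hP ⊢
    have h1 := hst _ (hconjD h hh) _ hP
    rwa [mul_smul, mul_smul, smul_inv_smul] at h1
  · intro h hh P
    rw [hmem₁]
    have h1 := hsg _ (hconjD h hh) (g⁻¹ • P)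
    rw [conj_smul_eq_iff g h ht₀, mul_smul, mul_smul, smul_inv_smul] at h1
    rwa [smul_sub, smul_comm g⁻¹ (if h • t₀ = t₀ then (1 : ℤ) else -1) P]
  · intro τ hτ P
    rw [hmem₁]
    have h1 := hin _ (hconjI τ hτ) (g⁻¹ • P)
    rw [mul_smul, mul_smul, smul_inv_smul] at h1
    rwa [smul_sub]

/-! ## §4. NON-SPLIT `E`: the good congruent partner has `a_p(A) ≡ -1 (mod p)` -/

set_option synthInstance.maxHeartbeats 100000 in
/-- **NON-SPLIT `E` ⟹ every good `p`-congruent partner `A` has `p ∣ a_p(A) + 1`** (`p` odd, any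
`E[p]`): `a_p(A) ≡ a_p(E) = -1 (mod p)`. With gen 24's `dvd_frobeniusTrace_sub_one_of_equiv_of_split`
(`a_p(A) ≡ +1` at a split pair) this is the census observation "`a_p(A) ≡ a_p(E)`" as a theorem.
Granted A41 (`hT`); `hordA` comes from `X11a/PartnerOrdinary.lean`. See the module docstring for the
proof. [cite: Serre1972, §1.11 (1), Prop. 11, §1.12] [cite: GreenbergVatsal2000, §2 pp. 14–15]
[cite: SilvermanATAEC1994, Ch. V Lemma 5.2 (c), Thm. 5.3, Cor. 5.4] -/
theorem dvd_frobeniusTrace_add_one_of_equiv_of_not_split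
    (hT : Silverman1994_thmV53_corV54_tateUniformisation.{0}) (hp2 : p ≠ 2)
    (hmult : W.HasMultiplicativeReductionAtPrime p)
    (hns : ¬ W.HasSplitMultiplicativeReductionAtPrime p)
    (hgoodA : A.HasGoodReductionAtPrime p)
    (e : geomTorsion A (p : ℤ) ≃+ geomTorsion W (p : ℤ))
    (he : ∀ (σ : absoluteGaloisGroup ℚ) (P : geomTorsion A (p : ℤ)), e (σ • P) = σ • e P) :
    (p : ℤ) ∣ A.frobeniusTrace p + 1 := by
  have hpp := hp.out
  have hp' : Prime (p : ℤ) := Nat.prime_iff_prime_int.mp hpp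
  set v : HeightOneSpectrum (𝓞 ℚ) := (Rat.HeightOneSpectrum.primesEquiv).symm ⟨p, hpp⟩ with hvdef
  have hv : (Rat.HeightOneSpectrum.primesEquiv v : ℕ) = p := by rw [hvdef, Equiv.apply_symm_apply]
  obtain ⟨𝔓, hmem, h𝔓⟩ := exists_ideal_placeOver p hv
  haveI : 𝔓.IsPrime := h𝔓.1
  -- A-side: the kernel of reduction `X_A` (order `p`, moved by `I_𝔓`), a Frobenius `σ` at `𝔓`
  have hordA : ¬ (p : ℤ) ∣ A.frobeniusTrace p :=
    PartnerOrdinary.not_dvd_frobeniusTrace_of_equiv_of_hasMultiplicativeReduction hp2 hmult hgoodA e he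
  have hΔ : ¬ (p : ℤ) ∣ minimalDiscriminantInt A :=
    A.not_dvd_minimalDiscriminantInt_of_hasGoodReductionAtPrime' p hgoodA
  set XA := ((geomReduction hΔ).comp (geomTorsion A (p : ℤ)).subtype).ker with hXAdef
  obtain ⟨hXAcard, ι, hι, Q₁, -, hιQ₁⟩ :=
    exists_mem_inertia_smul_ne_of_mem_ker hp2 hΔ hgoodA hordA hmem hv h𝔓
  obtain ⟨σ, hσ⟩ :=
    HeightOneSpectrum.exists_isArithFrobAt_of_mem_primesAbove_holds (K := ℚ) (v := v) h𝔓
  have hσD : σ ∈ 𝔓.decompositionSubgroup (absoluteGaloisGroup ℚ) := hσ.mem_stabilizer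
  -- E-side: `√γ` and its flip under `σ`
  obtain ⟨-, hc₄⟩ := Additive.dvd_and_not_dvd_c₄_of_hasMultiplicativeReductionAtPrime W p hmult
  have hc₆ := X2.GreenbergVatsalTateDatumRat.not_dvd_c₆_of_hasMultiplicativeReductionAtPrime W hmult
  set C₄ := (integralModelInt W).c₄ with hC₄
  set C₆ := (integralModelInt W).c₆ with hC₆
  have hG : ¬ (p : ℤ) ∣ -(C₄ * C₆) := fun h ↦ by
    rcases hp'.dvd_or_dvd (dvd_neg.mp h) with h4 | h6
    exacts [hc₄ h4, hc₆ h6]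
  have hEuler :=
    X2.GreenbergVatsalTateFrobeniusSign.int_dvd_pow_div_two_add_one_of_not_split W p hp2 hmult hns
  obtain ⟨t', ht'⟩ :=
    IsAlgClosed.exists_pow_nat_eq (((-(C₄ * C₆) : ℤ)) : AlgebraicClosure ℚ) two_pos
  have hflip : σ • t' = -t' := frob_smul_eq_neg_of_sq_eq_intCast hp2 hmem hv h𝔓 hσ hG hEuler ht'
  have hC₆0 : (C₆ : AlgebraicClosure ℚ) ≠ 0 := by
    have h : C₆ ≠ 0 := fun h0 ↦ hc₆ (by rw [h0]; exact dvd_zero _)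
    exact_mod_cast h
  have ht'0 : t' ≠ 0 := by
    intro h0
    rw [h0, zero_pow two_ne_zero, eq_comm, Int.cast_eq_zero, neg_eq_zero, mul_eq_zero] at ht'
    rcases ht' with h4 | h6
    exacts [hc₄ (by rw [h4]; exact dvd_zero _), hc₆ (by rw [h6]; exact dvd_zero _)]
  set t₀ := t' / (C₆ : AlgebraicClosure ℚ) with ht₀def
  have h4 : W.c₄ = (C₄ : ℚ) := by
    conv_lhs => rw [← WeierstrassCurve.map_integralModelInt W]
    rw [WeierstrassCurve.map_c₄, eq_intCast]
  have h6 : W.c₆ = (C₆ : ℚ) := by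
    conv_lhs => rw [← WeierstrassCurve.map_integralModelInt W]
    rw [WeierstrassCurve.map_c₆, eq_intCast]
  have ht₀ : t₀ ^ 2 = algebraMap ℚ (AlgebraicClosure ℚ) (-(W.c₄ / W.c₆)) := by
    rw [h4, h6, eq_ratCast, ht₀def, div_pow, ht']
    push_cast
    field_simp
  have ht₀0 : t₀ ≠ 0 := div_ne_zero ht'0 hC₆0
  have hσt₀ : σ • t₀ ≠ t₀ := by
    have hσt₀' : σ • t₀ = -t₀ := by
      rw [ht₀def, absoluteGaloisGroup.smul_def, map_div₀, map_intCast, ← absoluteGaloisGroup.smul_def,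
        hflip, neg_div]
    rw [hσt₀']
    intro h
    have h2 : (2 : AlgebraicClosure ℚ) * t₀ = 0 := by linear_combination (-1 : AlgebraicClosure ℚ) * h
    exact ht₀0 ((mul_eq_zero.mp h2).resolve_left two_ne_zero)
  -- the Tate line at `𝔓`
  obtain ⟨X₀, hX₀card, -, hX₀sg, hX₀in⟩ :=
    exists_tateLine_sign_of_mem_primesAbove hT hp2 hmult hv h𝔓 ht₀
  set Φ := XA.map e.toAddMonoidHom with hΦdef
  have hΦcard : Nat.card Φ = p := by
    rw [hΦdef, AddSubgroup.card_map_of_injective e.injective]; exact hXAcard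
  rcases X2.TateLineDecomposition.inf_eq_bot_or_eq W p hΦcard hX₀card with hbot | heq
  · -- `Φ ⊓ X₀ = 0`: `ι ∈ I_𝔓` moves `Q₁ ∈ X_A` but `ι Q₁ − Q₁ ∈ X_A` and `ι (e Q₁) − e Q₁ ∈ X₀`
    exfalso
    have h1 : ι • e Q₁ - e Q₁ ∈ X₀ := hX₀in ι hι (e Q₁)
    have h2 : ι • e Q₁ - e Q₁ ∈ Φ := by
      rw [← he, ← map_sub]
      exact AddSubgroup.mem_map.mpr
        ⟨ι • Q₁ - Q₁, smul_sub_self_mem_ker_of_mem_inertia hΔ hmem hι Q₁, rfl⟩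
    have h12 : ι • e Q₁ - e Q₁ ∈ (Φ ⊓ X₀ : AddSubgroup _) := ⟨h2, h1⟩
    rw [hbot, AddSubgroup.mem_bot, ← he, ← map_sub, map_eq_zero_iff e e.injective, sub_eq_zero]
      at h12
    exact hιQ₁ h12
  · -- `Φ = X₀`: `σ ≡ a_p(A)` and `σ ≡ -1` on `E[p]/X₀`, so `(a_p(A) + 1) E[p] ⊆ X₀`
    have hall : ∀ P : geomTorsion W (p : ℤ), (A.frobeniusTrace p + 1) • P ∈ X₀ := by
      intro P
      obtain ⟨Q, rfl⟩ := e.surjective P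
      have ha : σ • e Q - (A.frobeniusTrace p) • e Q ∈ X₀ := by
        rw [← heq, ← he, ← map_zsmul, ← map_sub]
        exact AddSubgroup.mem_map.mpr ⟨_, smul_sub_frobeniusTrace_smul_mem_ker hΔ hmem hv h𝔓 hσ Q, rfl⟩
      have hb : σ • e Q - (-1 : ℤ) • e Q ∈ X₀ := by
        have h := hX₀sg σ hσD (e Q)
        rwa [if_neg hσt₀] at h
      have hsub := X₀.sub_mem hb ha
      rwa [show σ • e Q - (-1 : ℤ) • e Q - (σ • e Q - A.frobeniusTrace p • e Q) =
          (A.frobeniusTrace p + 1) • e Q by rw [add_zsmul, neg_one_zsmul, one_zsmul]; abel] at hsub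
    by_contra hnd
    have hcop : IsCoprime (A.frobeniusTrace p + 1) (p : ℤ) :=
      ((Prime.coprime_iff_not_dvd hp').mpr hnd).symm
    obtain ⟨a₁, b₁, hab⟩ := hcop
    have htop : X₀ = ⊤ := by
      refine eq_top_iff.mpr fun P _ ↦ ?_
      have hpP : (p : ℤ) • P = 0 := Subtype.ext (by
        rw [AddSubgroupClass.coe_zsmul, ZeroMemClass.coe_zero]
        exact (mem_torsionPoints_iff _ _ (P : geomPoints W)).mp P.2)
      have hP : P = a₁ • ((A.frobeniusTrace p + 1) • P) + b₁ • ((p : ℤ) • P) := by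
        rw [smul_smul, smul_smul, ← add_smul, hab, one_smul]
      rw [hP, hpP, smul_zero, add_zero]
      exact X₀.zsmul_mem (hall P) a₁
    have hc := hX₀card
    rw [htop, AddSubgroup.card_top, Rank1Residual.natCard_geomTorsion W p] at hc
    have : p ^ 2 = p ^ 1 := by rw [pow_one]; exact hc
    exact absurd (Nat.pow_right_injective hpp.two_le this) (by norm_num)

end Summit.BirchSwinnertonDyer.Rank1Residual.X11a.PartnerNonsplitSign

end
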